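import Literature.NumberTheory.Automorphic.ClozelAlgebraicityHeckeFieldProofs
import Literature.LinearAlgebra.Semilinear.SimultaneousEigencharacterOrbit
import HarnessLib

/-!
# Clozel's theorem on the Hecke field, step 4(c): a finite-dimensional Hecke module in which every
# `Aut(ℂ/E)`-conjugate of the eigensystem occurs gives the Hecke field (proofs)

Topic `Literature/NumberTheory/Automorphic`; namespace `Literature.NumberTheory.Automorphic`.
PROOFS file (theorems only: no definition, no named fact, no instance), third companion of
`ClozelAlgebraicity.lean` for the named fact `Clozel1990_heckeEigenvalueField` (Clozel 1990,
Thm. 3.13 in Hecke-eigenvalue form: for `π` cuspidal regular algebraic on `GL_n(𝔸_K)` the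
unramified Hecke eigenvalues `t_{v,i} = q_v^{i(n-i)/2} e_i(α_v)` at all but finitely many `v` lie
in ONE number field), after `ClozelAlgebraicityHeckeFieldProofs.lean` (step 4(a): a rational
FINITE-DIMENSIONAL realisation of the eigensystem; step 4(b): finitely many
`Aut(ℂ/E)`-conjugates of the eigensystem, `heckeEigenvalue_mem_subfield_of_finite_autOrbit`).

## What is proved: the shape in which Clozel's §3.5 actually argues

Clozel's proof of Thm. 3.13 (§3.5, pp. 122–123; re-proved as Grobner–Raghuram 2014, Thm. 42 with
Prop. 45 and Thm. 50) does not exhibit a rational eigenvector: it lets `σ ∈ Aut(ℂ/ℚ(λ))` act on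
the cuspidal cohomology `H = H^•_cusp(S̃_{K_f}, Ṽ_λ ⊗ ℂ)` (σ-semilinearly, through the
`ℚ(λ)`-structure of Betti cohomology, commuting with the Hecke operators, which are defined over
`ℚ`), observes that `^σπ_f^{K_f}` then OCCURS in the same space `H`, and concludes from
`dim_ℂ H < ∞` that `π_f` has finitely many conjugates, whence `[ℚ(π_f) : ℚ] < ∞`. This file proves
exactly that implication on the tree's carriers, with the cohomology abstracted to a
finite-dimensional complex vector space `H` with operators `T v i`:

* `heckeEigenvalue_mem_subfield_of_conjugates_occur` — if `H` is finite-dimensional over `ℂ`,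
  `E ⊆ ℂ` is finite over `ℚ`, and for every `σ ∈ Aut(ℂ/E)` some non-zero `y_σ ∈ H` has
  `T v i y_σ = σ(t_{v,i}) y_σ` for all `v ∉ S` at which `π` has a Satake parameter and all `i ≤ n`
  (the `σ`-conjugate eigensystem occurs in `H`; `σ = 1` says the eigensystem of `π` itself occurs),
  then the `t_{v,i}`, `v ∉ S`, lie in a subfield of `ℂ` finite over `ℚ`. Proof: the simultaneous
  eigencharacters of the family `(T v i)` on the finite-dimensional `H` form a finite set
  (`Literature.LinearAlgebra.Semilinear.finite_setOf_simultaneous_eigencharacter`: eigenvectors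
  with distinct eigencharacters are linearly independent), which contains every conjugate system;
  then step 4(b) (`heckeEigenvalue_mem_subfield_of_finite_autOrbit`: the stabiliser has finite
  index in `Aut(ℂ/E)`, Artin). No uniqueness of Satake parameters is needed (two parameters at `v`
  give the same eigenvalue on the non-zero `y_σ`).
* `heckeEigenvalue_mem_subfield_of_semilinearSymmetry` — the symmetry form: ONE non-zero
  eigenvector `x ∈ H` of the eigensystem off `S` and, for every `σ ∈ Aut(ℂ/E)`, a map
  `g_σ : H → H`, `σ`-semilinear on `ℂ x`, commuting with the `T v i` (`v ∉ S`, `i ≤ n`) and with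
  `g_σ x ≠ 0` (in print: `g_σ = H^•(1 ⊗ σ)` on `H^•(Γ, V_λ(ℚ(λ)) ⊗_{ℚ(λ)} ℂ)`, an invertible
  `σ`-semilinear map by functoriality of cohomology in the coefficients).
* `…_cofinite_…` versions (finite `S`, conclusion at all but finitely many places), and the
  fact-level statements `Clozel1990_heckeEigenvalueField_of_conjugatesOccur` /
  `Clozel1990_heckeEigenvalueField_of_semilinearSymmetry`: if every cuspidal regular algebraic `π`
  on every `GL_n(𝔸_K)` has such a finite-dimensional receptacle, the named fact holds.

Compared with step 4(a) this removes the rational structure (and with it the surjectivity of the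
base change `H^•(Γ, V_λ(ℚ(λ))) ⊗ ℂ → H^•(Γ, V_λ(ℂ))`) from the inputs: what remains to discharge
`Clozel1990_heckeEigenvalueField` along these lines is (1) the cohomological receptacle over a
general number field `K` with its Hecke operators (over `ℚ`: `GLnCohomology.levelCohomology`),
(2) the Borel–Franke–Clozel eigenclass of a cuspidal regular algebraic `π` in it (over `ℚ`: the
named fact `GLnCohomology.cuspidalEigenclass_exists`; Clozel Lemme 3.14–3.15, Franke Thm. 18),
(3) its finite-dimensionality (Borel–Serre; the named fact
`BorelSerre1973_finiteDimensional_groupCohomology`) and (4) the formal `σ`-semilinear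
functoriality of group cohomology in the coefficient module. Not here: any of (1)–(4).

## References

* L. Clozel, *Motifs et formes automorphes: applications du principe de fonctorialité*, in
  Automorphic forms, Shimura varieties, and L-functions I (Ann Arbor 1988), Perspect. Math. 10,
  Academic Press 1990, Thm. 3.13 and its proof, §3.5 (pp. 122–123); Thm. 3.19. [Clozel1990]
* H. Grobner, A. Raghuram, *On some arithmetic properties of automorphic forms of GL_m over a
  division algebra*, Int. J. Number Theory 10 (2014) = arXiv:1102.1872, §7 Prop. 45, §8 Thm. 50.
  [GrobnerRaghuram2014]
-/

noncomputable section

open scoped Classical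
open NumberField IsDedekindDomain IntermediateField

namespace Literature.NumberTheory.Automorphic

section Occur

variable {n : ℕ} {K : Type} [Field K] [NumberField K] {hcpt : isCompact_glFiniteIntegralLevel n K}

/-- **Clozel's Thm. 3.13 (Hecke field) from a finite-dimensional Hecke module in which every
`Aut(ℂ/E)`-conjugate of the eigensystem occurs** (Clozel 1990, §3.5: `^σπ_f` occurs in the
finite-dimensional `H^•_cusp(S̃_{K_f}, Ṽ_λ ⊗ ℂ)` for every `σ ∈ Aut(ℂ/ℚ(λ))`). Let `π` be an
automorphic representation of `GL_n(𝔸_K)`, `E ⊆ ℂ` finite over `ℚ`, `S` a set of finite places,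
`H` a finite-dimensional complex vector space with operators `T v i`, and suppose that for every
`σ ∈ Aut(ℂ/E)` some non-zero `y ∈ H` satisfies `T v i y = σ(t_{v,i}) • y` for all `v ∉ S`, all
Satake parameters `α` of `π` at `v` (`t_{v,i} = heckeEigenvalueOf n v α i`) and all `i ≤ n`. Then
the `t_{v,i}`, `v ∉ S`, lie in one subfield of `ℂ` finite over `ℚ`: the conjugate eigensystems are
simultaneous eigencharacters of `(T v i)` on `H`, a finite set
(`finite_setOf_simultaneous_eigencharacter`), and `heckeEigenvalue_mem_subfield_of_finite_autOrbit`
applies. [cite: Clozel1990, Thm. 3.13 (proof, §3.5)] -/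
theorem heckeEigenvalue_mem_subfield_of_conjugates_occur
    (π : AutomorphicRepData (AutomorphyDatum.gl n K hcpt)) (E : IntermediateField ℚ ℂ)
    [FiniteDimensional ℚ E] (S : Set (HeightOneSpectrum (𝓞 K)))
    {H : Type*} [AddCommGroup H] [Module ℂ H] [FiniteDimensional ℂ H]
    (T : HeightOneSpectrum (𝓞 K) → ℕ → Module.End ℂ H)
    (hocc : ∀ σ : ℂ ≃ₐ[ℚ] ℂ, σ ∈ E.fixingSubgroup → ∃ y : H, y ≠ 0 ∧
      ∀ v ∉ S, ∀ α : Multiset ℂ, π.HasSatakeParamAt v α → ∀ i ≤ n,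
        T v i y = σ (heckeEigenvalueOf n v α i) • y) :
    ∃ E' : Subfield ℂ, FiniteDimensional ℚ E' ∧ ∀ v ∉ S, ∀ α : Multiset ℂ,
      π.HasSatakeParamAt v α → ∀ i ≤ n, heckeEigenvalueOf n v α i ∈ E' := by
  -- the operators at the unramified places off `S`, indexed by `(v, i)`, `i ≤ n`
  let ι := {p : HeightOneSpectrum (𝓞 K) × ℕ // p.1 ∉ S ∧ π.IsUnramifiedAt p.1 ∧ p.2 ≤ n}
  let T' : ι → Module.End ℂ H := fun p ↦ T p.1.1 p.1.2
  -- their simultaneous eigencharacters: a finite set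
  set Θ : Set (ι → ℂ) := {θ | ∃ y : H, y ≠ 0 ∧ ∀ p, T' p y = θ p • y} with hΘ
  have hΘfin : Θ.Finite :=
    Literature.LinearAlgebra.Semilinear.finite_setOf_simultaneous_eigencharacter T'
  -- extension by zero to systems indexed by all `(v, i)`
  let ext : (ι → ℂ) → HeightOneSpectrum (𝓞 K) → ℕ → ℂ := fun θ v i ↦
    if h : v ∉ S ∧ π.IsUnramifiedAt v ∧ i ≤ n then θ ⟨(v, i), h⟩ else 0
  let F : Finset (HeightOneSpectrum (𝓞 K) → ℕ → ℂ) := hΘfin.toFinset.image ext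
  refine heckeEigenvalue_mem_subfield_of_finite_autOrbit π E S F fun σ hσ ↦ ?_
  obtain ⟨y, hy, hTy⟩ := hocc σ hσ
  -- the `σ`-conjugate system, read off at a chosen Satake parameter of each unramified place
  let θσ : ι → ℂ := fun p ↦ σ (heckeEigenvalueOf n p.1.1 (Classical.choose p.2.2.1) p.1.2)
  have hθσ : ∀ p : ι, T' p y = θσ p • y := fun p ↦
    hTy p.1.1 p.2.1 _ (Classical.choose_spec p.2.2.1) p.1.2 p.2.2.2
  have hmem : θσ ∈ Θ := ⟨y, hy, hθσ⟩
  refine ⟨ext θσ, Finset.mem_image.mpr ⟨θσ, hΘfin.mem_toFinset.mpr hmem, rfl⟩, ?_⟩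
  intro v hv α hα i hi
  have hur : π.IsUnramifiedAt v := ⟨α, hα⟩
  have hp : v ∉ S ∧ π.IsUnramifiedAt v ∧ i ≤ n := ⟨hv, hur, hi⟩
  show σ (heckeEigenvalueOf n v α i) = ext θσ v i
  simp only [ext, hp, dif_pos, not_false_eq_true, and_self]
  -- both `σ(t_{v,i}(α))` and `θσ (v, i)` are the eigenvalue of `T v i` on the non-zero `y`
  have h1 : T v i y = σ (heckeEigenvalueOf n v α i) • y := hTy v hv α hα i hi
  have h2 : T v i y = θσ ⟨(v, i), hp⟩ • y := hθσ ⟨(v, i), hp⟩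
  exact smul_left_injective ℂ hy (h1.symm.trans h2)

/-- `heckeEigenvalue_mem_subfield_of_conjugates_occur` with a finite exceptional set `S`,
conclusion at all but finitely many places (the shape of `Clozel1990_heckeEigenvalueField`).
[cite: Clozel1990, Thm. 3.13 (proof, §3.5)] -/
theorem heckeEigenvalue_mem_subfield_cofinite_of_conjugates_occur
    (π : AutomorphicRepData (AutomorphyDatum.gl n K hcpt)) (E : IntermediateField ℚ ℂ)
    [FiniteDimensional ℚ E] {S : Set (HeightOneSpectrum (𝓞 K))} (hS : S.Finite)
    {H : Type*} [AddCommGroup H] [Module ℂ H] [FiniteDimensional ℂ H]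
    (T : HeightOneSpectrum (𝓞 K) → ℕ → Module.End ℂ H)
    (hocc : ∀ σ : ℂ ≃ₐ[ℚ] ℂ, σ ∈ E.fixingSubgroup → ∃ y : H, y ≠ 0 ∧
      ∀ v ∉ S, ∀ α : Multiset ℂ, π.HasSatakeParamAt v α → ∀ i ≤ n,
        T v i y = σ (heckeEigenvalueOf n v α i) • y) :
    ∃ E' : Subfield ℂ, FiniteDimensional ℚ E' ∧
      ∀ᶠ v : HeightOneSpectrum (𝓞 K) in Filter.cofinite, ∀ α : Multiset ℂ,
        π.HasSatakeParamAt v α → ∀ i ≤ n, heckeEigenvalueOf n v α i ∈ E' := by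
  obtain ⟨E', hE', hmem⟩ := heckeEigenvalue_mem_subfield_of_conjugates_occur π E S T hocc
  refine ⟨E', hE', ?_⟩
  have hSc : Sᶜ ∈ Filter.cofinite := Filter.mem_cofinite.mpr (by simpa using hS)
  filter_upwards [hSc] with v hv
  exact hmem v hv

/-- **The symmetry form** (Clozel 1990, §3.5 with Thm. 3.19: `Aut(ℂ/ℚ(λ))` acts semilinearly on
`H^•_cusp(S̃, Ṽ_λ ⊗ ℂ)` commuting with the Hecke operators). Let `H` be a finite-dimensional
complex vector space with operators `T v i`, `x ∈ H` a simultaneous eigenvector off `S` with the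
unramified Hecke eigenvalues of `π` (`T v i x = t_{v,i} x` whenever `π` has Satake
parameter `α` at `v ∉ S`, `i ≤ n`), and suppose every `σ ∈ Aut(ℂ/E)` (`E ⊆ ℂ` finite over `ℚ`)
admits a map `g : H → H`, `σ`-semilinear on the line `ℂ x` (`g (c • x) = σ c • g x`), commuting
with the `T v i` for `v ∉ S`, `i ≤ n`, and with `g x ≠ 0`. Then the `t_{v,i}`, `v ∉ S`, lie in one
subfield of `ℂ` finite over `ℚ` (`g x` witnesses that the `σ`-conjugate system occurs:
`heckeEigenvalue_mem_subfield_of_conjugates_occur`). [cite: Clozel1990, Thm. 3.13 (proof, §3.5) and Thm. 3.19] -/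
theorem heckeEigenvalue_mem_subfield_of_semilinearSymmetry
    (π : AutomorphicRepData (AutomorphyDatum.gl n K hcpt)) (E : IntermediateField ℚ ℂ)
    [FiniteDimensional ℚ E] (S : Set (HeightOneSpectrum (𝓞 K)))
    {H : Type*} [AddCommGroup H] [Module ℂ H] [FiniteDimensional ℂ H]
    (T : HeightOneSpectrum (𝓞 K) → ℕ → Module.End ℂ H) {x : H}
    (hxT : ∀ v ∉ S, ∀ α : Multiset ℂ, π.HasSatakeParamAt v α → ∀ i ≤ n,
      T v i x = heckeEigenvalueOf n v α i • x)
    (hsymm : ∀ σ : ℂ ≃ₐ[ℚ] ℂ, σ ∈ E.fixingSubgroup → ∃ g : H → H, g x ≠ 0 ∧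
      (∀ c : ℂ, g (c • x) = σ c • g x) ∧ ∀ v ∉ S, ∀ i ≤ n, T v i (g x) = g (T v i x)) :
    ∃ E' : Subfield ℂ, FiniteDimensional ℚ E' ∧ ∀ v ∉ S, ∀ α : Multiset ℂ,
      π.HasSatakeParamAt v α → ∀ i ≤ n, heckeEigenvalueOf n v α i ∈ E' := by
  refine heckeEigenvalue_mem_subfield_of_conjugates_occur π E S T fun σ hσ ↦ ?_
  obtain ⟨g, hg0, hg, hcomm⟩ := hsymm σ hσ
  refine ⟨g x, hg0, fun v hv α hα i hi ↦ ?_⟩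
  rw [hcomm v hv i hi, hxT v hv α hα i hi, hg]

/-- `heckeEigenvalue_mem_subfield_of_semilinearSymmetry` with a finite exceptional set `S`,
conclusion at all but finitely many places. [cite: Clozel1990, Thm. 3.13 (proof, §3.5) and Thm. 3.19] -/
theorem heckeEigenvalue_mem_subfield_cofinite_of_semilinearSymmetry
    (π : AutomorphicRepData (AutomorphyDatum.gl n K hcpt)) (E : IntermediateField ℚ ℂ)
    [FiniteDimensional ℚ E] {S : Set (HeightOneSpectrum (𝓞 K))} (hS : S.Finite)
    {H : Type*} [AddCommGroup H] [Module ℂ H] [FiniteDimensional ℂ H]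
    (T : HeightOneSpectrum (𝓞 K) → ℕ → Module.End ℂ H) {x : H}
    (hxT : ∀ v ∉ S, ∀ α : Multiset ℂ, π.HasSatakeParamAt v α → ∀ i ≤ n,
      T v i x = heckeEigenvalueOf n v α i • x)
    (hsymm : ∀ σ : ℂ ≃ₐ[ℚ] ℂ, σ ∈ E.fixingSubgroup → ∃ g : H → H, g x ≠ 0 ∧
      (∀ c : ℂ, g (c • x) = σ c • g x) ∧ ∀ v ∉ S, ∀ i ≤ n, T v i (g x) = g (T v i x)) :
    ∃ E' : Subfield ℂ, FiniteDimensional ℚ E' ∧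
      ∀ᶠ v : HeightOneSpectrum (𝓞 K) in Filter.cofinite, ∀ α : Multiset ℂ,
        π.HasSatakeParamAt v α → ∀ i ≤ n, heckeEigenvalueOf n v α i ∈ E' := by
  obtain ⟨E', hE', hmem⟩ :=
    heckeEigenvalue_mem_subfield_of_semilinearSymmetry π E S T hxT hsymm
  refine ⟨E', hE', ?_⟩
  have hSc : Sᶜ ∈ Filter.cofinite := Filter.mem_cofinite.mpr (by simpa using hS)
  filter_upwards [hSc] with v hv
  exact hmem v hv

end Occur

/-! ### The named fact from a finite-dimensional receptacle for every cuspidal regular algebraic `π` -/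

/-- **`Clozel1990_heckeEigenvalueField` from steps 1–3 of the printed proof in the
"conjugates occur" form.** If for every cuspidal regular algebraic `π` on every `GL_n(𝔸_K)` there
are a subfield `E ⊆ ℂ` finite over `ℚ`, a finite set `S` of finite places and a finite-dimensional
complex vector space `H` with operators `T v i` in which, for every `σ ∈ Aut(ℂ/E)`, the
`σ`-conjugate of the unramified eigensystem of `π` off `S` occurs on a non-zero vector (in print:
`E = ℚ(λ)`, `S` = the places dividing the level, `H = H^•_cusp(S̃_{K_f}, Ṽ_λ ⊗ ℂ)` with the
`T_{v,i}`, the vector being the class of `^σπ_f^{K_f}`: Clozel 1990, Lemme 3.14–3.15, Thm. 3.19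
and §3.5; Grobner–Raghuram 2014, Prop. 45), then the named fact holds
(`heckeEigenvalue_mem_subfield_cofinite_of_conjugates_occur`).
[cite: Clozel1990, Thm. 3.13 (proof, §3.5)] -/
theorem Clozel1990_heckeEigenvalueField_of_conjugatesOccur
    (hocc : ∀ (n : ℕ) (K : Type) [Field K] [NumberField K]
      (hcpt : isCompact_glFiniteIntegralLevel n K) (π : CuspidalAutomorphicRepData n K hcpt),
      π.1.IsRegularAlgebraic →
      ∃ (E : IntermediateField ℚ ℂ) (_ : FiniteDimensional ℚ E)
        (S : Set (HeightOneSpectrum (𝓞 K))) (_ : S.Finite)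
        (H : Type) (_ : AddCommGroup H) (_ : Module ℂ H) (_ : FiniteDimensional ℂ H)
        (T : HeightOneSpectrum (𝓞 K) → ℕ → Module.End ℂ H),
        ∀ σ : ℂ ≃ₐ[ℚ] ℂ, σ ∈ E.fixingSubgroup → ∃ y : H, y ≠ 0 ∧
          ∀ v ∉ S, ∀ α : Multiset ℂ, π.1.HasSatakeParamAt v α → ∀ i ≤ n,
            T v i y = σ (heckeEigenvalueOf n v α i) • y) :
    Clozel1990_heckeEigenvalueField := by
  intro n K _ _ hcpt π hπ
  obtain ⟨E, hE, S, hS, H, _, _, hH, T, h⟩ := hocc n K hcpt π hπ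
  haveI := hE
  haveI := hH
  exact heckeEigenvalue_mem_subfield_cofinite_of_conjugates_occur π.1 E hS T h

/-- **`Clozel1990_heckeEigenvalueField` from steps 1–3 in the symmetry form**: for every cuspidal
regular algebraic `π`, a finite-dimensional complex Hecke module `H` containing an
eigenvector `x` of the unramified eigensystem of `π` off a finite set `S`, on which every
`σ ∈ Aut(ℂ/E)` (`E` a number field) acts by a map `σ`-semilinear on `ℂ x`, commuting with the
`T v i` off `S` and not killing `x` (Clozel 1990, §3.5 with Thm. 3.19), gives the named fact
(`heckeEigenvalue_mem_subfield_cofinite_of_semilinearSymmetry`).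
[cite: Clozel1990, Thm. 3.13 (proof, §3.5) and Thm. 3.19] -/
theorem Clozel1990_heckeEigenvalueField_of_semilinearSymmetry
    (hsymm : ∀ (n : ℕ) (K : Type) [Field K] [NumberField K]
      (hcpt : isCompact_glFiniteIntegralLevel n K) (π : CuspidalAutomorphicRepData n K hcpt),
      π.1.IsRegularAlgebraic →
      ∃ (E : IntermediateField ℚ ℂ) (_ : FiniteDimensional ℚ E)
        (S : Set (HeightOneSpectrum (𝓞 K))) (_ : S.Finite)
        (H : Type) (_ : AddCommGroup H) (_ : Module ℂ H) (_ : FiniteDimensional ℂ H)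
        (T : HeightOneSpectrum (𝓞 K) → ℕ → Module.End ℂ H) (x : H),
        (∀ v ∉ S, ∀ α : Multiset ℂ, π.1.HasSatakeParamAt v α → ∀ i ≤ n,
          T v i x = heckeEigenvalueOf n v α i • x) ∧
        ∀ σ : ℂ ≃ₐ[ℚ] ℂ, σ ∈ E.fixingSubgroup → ∃ g : H → H, g x ≠ 0 ∧
          (∀ c : ℂ, g (c • x) = σ c • g x) ∧ ∀ v ∉ S, ∀ i ≤ n, T v i (g x) = g (T v i x)) :
    Clozel1990_heckeEigenvalueField := by
  intro n K _ _ hcpt π hπ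
  obtain ⟨E, hE, S, hS, H, _, _, hH, T, x, hxT, h⟩ := hsymm n K hcpt π hπ
  haveI := hE
  haveI := hH
  exact heckeEigenvalue_mem_subfield_cofinite_of_semilinearSymmetry π.1 E hS T hxT h

end Literature.NumberTheory.Automorphic
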